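import Literature.NumberTheory.Automorphic.UnitaryGroupSymplecticEmbedding   -- ★ `hermForm σ H x y = (σ ∘ x) ⬝ᵥ (H *ᵥ y)`, `hermForm_mulVec` (invariance under `U(σ, H)`)
import Literature.NumberTheory.Rogawski1990.KottwitzSteinbergRankThree       -- ★ `Rogawski1990.hermForm_smul_left` ∕ `hermForm_smul_right` ∕ `hermForm_add_left` ∕ `hermForm_add_right` (reused, not restated)
import Mathlib.LinearAlgebra.Matrix.Charpoly.Coeff
import Mathlib.LinearAlgebra.Matrix.Adjugate
import Mathlib.FieldTheory.Separable
import HarnessLib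

/-!
# F0 · P3c · line LH6 «StCharTS» — «ELL-CRIT★» (E2) KIT: THE ADJUGATE EIGENVECTOR ENGINE AND THE HERMITIAN PAIRING ALGEBRA
# (generic bricks for `Theorems/F0P3cStCharTSEllipticCriterionConverse`) [Rogawski1990 §12.5 p. 182; §1.9–§1.10]

Cell `pub/hodgecm-mathlib`, crux H413 = `stmt-HodgeConjecture-24833` (`--supports` lane, helper), route HCCMUnconditional; seat F0P2-p02 (g15),
deal «ELL-CRIT★» of F0P3b-plan (g23) 2026-09-02T05:43:16Z, part (E2).  THEOREMS ONLY, sorry-free, no definition ∕ instance ∕ notation ∕ named fact.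

PURPOSE.  The converse direction of the eigenvalue test for the split torus of `U(σ, Φ₃)` («a unitary `γ` with an eigenvalue `α`, `α σ(α) ≠ 1`, is
`U`-conjugate into `M`») is proved in the sequel by an EXPLICIT HYPERBOLIC–ORTHOGONAL EIGENFRAME.  This file holds the two generic engines it runs on,
stated over an arbitrary commutative ring so that they serve every carrier of the line:

* §1 THE HERMITIAN PAIRING `h(x, y) = hermForm σ J x y = (σ ∘ x) ⬝ᵥ (J *ᵥ y)` (★ `UnitaryGroupSymplecticEmbedding`; one-sided scalings ★
  `Rogawski1990.hermForm_smul_left` ∕ `hermForm_smul_right` of ★ `KottwitzSteinbergRankThree` are REUSED, not restated): the row-functional form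
  `h(x, y) = ((σ ∘ x) ᵥ* J) ⬝ᵥ y`, joint sesquilinearity `h(c x, d y) = σ(c) d h(x, y)`, HERMITIAN SYMMETRY `h(y, x) = σ(h(x, y))` for an involutive `σ` and a
  `σ`-fixed symmetric `J`, the GRAM ENTRIES `((σA)ᵀ J A)ᵢⱼ = h(col i, col j)`, and the EIGEN-ORTHOGONALITY relation `(σ(a) b − 1) h(x, y) = 0` for
  `γ ∈ U(σ, J)`, `γ x = a x`, `γ y = b y` (from ★ `hermForm_mulVec`) — whence isotropy of an eigenvector with `a σ(a) ≠ 1`.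
* §2 THE ADJUGATE EIGENVECTOR ENGINE for `3 × 3` matrices: JACOBI'S FORMULA `tr adj(t·1 − M) = (d/dt charpoly M)(t)` (explicit expansion), the
  RANK-ONE identity `(adj A · adj A)ᵢᵢ = (adj A)ᵢᵢ · tr adj A` for a SINGULAR `A` (the diagonal `2 × 2` minors of the adjugate of a singular `3 × 3` matrix
  vanish), and, for any size, «the columns (rows) of `adj(t·1 − M)` are right (left) `t`-eigenvectors of `M`» when `det(t·1 − M) = 0` (`A · adj A = det A · 1`).
  Together: at a SIMPLE root `t` of `charpoly M` (separable characteristic polynomial) the adjugate `Q = adj(t·1 − M)` has a non-zero diagonal entry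
  `Q i i` and the right eigenvector `Q eᵢ` PAIRS NON-TRIVIALLY with the left eigenvector `eᵢᵀ Q` (`eᵢᵀ Q · Q eᵢ = Q i i · tr Q ≠ 0`) — the
  non-degeneracy that drives the frame of the sequel without any Witt ∕ Borel–Levi ∕ dimension argument.
HONEST LABEL: HC_CM is proved only modulo the 7 printed citations (2 remaining: hLiu418 = `stmt-HodgeConjecture-24832`, h413 = `stmt-HodgeConjecture-24833`)
until rung 0 closes; this file is count-neutral linear algebra and closes no organ.

## References
* [Rogawski1990] J. D. Rogawski, *Automorphic Representations of Unitary Groups in Three Variables*, Ann. of Math. Stud. 123 (1990), §12.5 p. 182 (the split torus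
  and its regular conjugates), §1.9–§1.10 pp. 8–9 (the form `Φ`, `M = {d(α, β, ᾱ⁻¹)}`).
* [HornJohnson2013] R. A. Horn, C. R. Johnson, *Matrix Analysis*, 2nd ed. (2013), §0.8.2 (adjugate; rank of the adjugate of a singular matrix), (0.8.10.1)
  (Jacobi's formula `d det = tr(adj · d)`), §1.4 (left and right eigenvectors at a simple eigenvalue are not orthogonal).
-/

set_option autoImplicit false
set_option linter.dupNamespace false

open Matrix Polynomial
open Literature.NumberTheory.Automorphic Literature.NumberTheory.Automorphic.UnitaryGroup

namespace Summit.HodgeConjecture.HodgeConjecture.Cruxes.H413.F0P3cStCharTSAdjugateEigen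

/-! ## §1 The Hermitian pairing `h(x, y) = (σ ∘ x) ⬝ᵥ (J *ᵥ y)`: row functional, sesquilinearity, Hermitian symmetry, Gram entries, eigen-orthogonality -/

section Pairing

variable {R : Type*} [CommRing R] (σ : R →+* R) {n : Type*} [Fintype n]

/-- `h(x, y) = ((σ ∘ x) J) · y` — the pairing as the dot product with the ROW FUNCTIONAL `(σ ∘ x) ᵥ* J` of `x`. [folklore] -/
theorem hermForm_eq_vecMul_dotProduct (J : Matrix n n R) (x y : n → R) :
    hermForm σ J x y = ((⇑σ ∘ x) ᵥ* J) ⬝ᵥ y := by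
  rw [hermForm_apply, dotProduct_mulVec]

/-- **Sesquilinearity**: `h(c x, d y) = σ(c) d h(x, y)` (`σ`-semilinear in the first slot, linear in the second). [folklore] -/
theorem hermForm_smul_smul_eq (J : Matrix n n R) (c d : R) (x y : n → R) :
    hermForm σ J (c • x) (d • y) = σ c * d * hermForm σ J x y := by
  have h1 : (⇑σ ∘ (c • x)) = σ c • (⇑σ ∘ x) := funext fun i => by simp
  rw [hermForm_apply, hermForm_apply, h1, mulVec_smul, smul_dotProduct, dotProduct_smul, smul_eq_mul, smul_eq_mul, mul_assoc]

/-- **Hermitian symmetry** `h(y, x) = σ(h(x, y))` when `σ` is an involution and `J` is a `σ`-fixed SYMMETRIC matrix (the tree's `Φ_N = (StdForm.antidiagonal N).over R`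
has integer entries). [cite: Rogawski1990, §1.9 p. 8] -/
theorem hermForm_comm {J : Matrix n n R} (hσ : ∀ a, σ (σ a) = a) (hJt : Jᵀ = J) (hJσ : J.map σ = J) (x y : n → R) :
    hermForm σ J y x = σ (hermForm σ J x y) := by
  have hJ' : ∀ k l, σ (J k l) = J k l := fun k l => by
    simpa only [map_apply] using congrFun (congrFun hJσ k) l
  have hJs : ∀ k l, J l k = J k l := fun k l => by
    simpa only [transpose_apply] using congrFun (congrFun hJt k) l
  simp only [hermForm_apply, dotProduct, mulVec, Function.comp_apply, map_sum, map_mul, hσ, hJ', Finset.mul_sum]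
  rw [Finset.sum_comm]
  exact Finset.sum_congr rfl fun k _ => Finset.sum_congr rfl fun l _ => by rw [hJs k l]; ring

/-- **Gram entries**: `((σA)ᵀ J A)ᵢⱼ = h(col i of A, col j of A)` — membership of `A` in `U(σ, J)` is the statement that its columns form a `J`-frame for `h`.
[cite: Rogawski1990, §1.9 p. 8] -/
theorem transpose_map_mul_mul_apply (J A : Matrix n n R) (i j : n) :
    ((A.map σ)ᵀ * J * A) i j = hermForm σ J (fun k => A k i) (fun k => A k j) := by
  simp only [mul_apply, transpose_apply, map_apply, hermForm_apply, dotProduct, mulVec, Function.comp_apply, Finset.mul_sum,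
    Finset.sum_mul]
  rw [Finset.sum_comm]
  exact Finset.sum_congr rfl fun k _ => Finset.sum_congr rfl fun l _ => by ring

/-- **Eigen-orthogonality**: if `(σM)ᵀ J M = J` (`M ∈ U(σ, J)`) and `M x = a x`, `M y = b y`, then `(σ(a) b − 1) · h(x, y) = 0` — `h(Mx, My) = h(x, y)` and
`h(a x, b y) = σ(a) b h(x, y)`.  In particular an eigenvector with `σ(a) a ≠ 1` is ISOTROPIC (over a domain). [cite: Rogawski1990, §12.5 p. 182] -/
theorem sub_one_mul_hermForm_eq_zero_of_eigen {J M : Matrix n n R} (hM : (M.map σ)ᵀ * J * M = J) {x y : n → R} {a b : R}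
    (hx : M *ᵥ x = a • x) (hy : M *ᵥ y = b • y) : (σ a * b - 1) * hermForm σ J x y = 0 := by
  have h := hermForm_mulVec σ hM x y
  rw [hx, hy, hermForm_smul_smul_eq] at h
  rw [sub_mul, one_mul, h, sub_self]

end Pairing

/-! ## §2 The adjugate eigenvector engine: Jacobi's trace formula, rank one of the adjugate of a singular `3 × 3` matrix, adjugate columns ∕ rows are eigenvectors -/

section Adjugate

variable {R : Type*} [CommRing R]

/-- **Jacobi's formula for `3 × 3` matrices**: `tr adj(t·1 − M) = (d/dt det(t·1 − M))(t) = charpoly′(M)(t)` (explicit expansion of both sides).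
[cite: HornJohnson2013, (0.8.10.1)] -/
theorem trace_adjugate_scalar_sub_eq_eval_derivative_charpoly (M : Matrix (Fin 3) (Fin 3) R) (t : R) :
    trace (adjugate (scalar (Fin 3) t - M)) = (derivative M.charpoly).eval t := by
  rw [Matrix.charpoly, det_fin_three]
  simp only [charmatrix_apply_eq, charmatrix_apply_ne _ _ _ (by decide : (0 : Fin 3) ≠ 1),
    charmatrix_apply_ne _ _ _ (by decide : (0 : Fin 3) ≠ 2), charmatrix_apply_ne _ _ _ (by decide : (1 : Fin 3) ≠ 0),
    charmatrix_apply_ne _ _ _ (by decide : (1 : Fin 3) ≠ 2), charmatrix_apply_ne _ _ _ (by decide : (2 : Fin 3) ≠ 0),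
    charmatrix_apply_ne _ _ _ (by decide : (2 : Fin 3) ≠ 1)]
  simp only [derivative_mul, derivative_sub, derivative_add, derivative_neg, derivative_X, derivative_C, sub_zero,
    eval_add, eval_sub, eval_mul, eval_neg, eval_X, eval_C, eval_one, eval_zero]
  rw [trace_fin_three, adjugate_fin_three]
  simp [Matrix.sub_apply, Matrix.scalar_apply]
  ring

/-- **Rank one of the adjugate of a SINGULAR `3 × 3` matrix, on the diagonal**: `det A = 0 ⇒ (adj A · adj A)ᵢᵢ = (adj A)ᵢᵢ · tr (adj A)` (each diagonal `2 × 2` minor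
`(adj A)ᵢᵢ (adj A)ₖₖ − (adj A)ᵢₖ (adj A)ₖᵢ` equals `det A` times the complementary entry of `A`). [cite: HornJohnson2013, §0.8.2] -/
theorem adjugate_mul_adjugate_apply_self_of_det_eq_zero (A : Matrix (Fin 3) (Fin 3) R) (h : A.det = 0) (i : Fin 3) :
    (adjugate A * adjugate A) i i = adjugate A i i * trace (adjugate A) := by
  rw [det_fin_three] at h
  rw [trace_fin_three, mul_apply, Fin.sum_univ_three, adjugate_fin_three]
  fin_cases i <;> simp <;>
    first
      | linear_combination (A 1 1 + A 2 2) * h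
      | linear_combination (A 0 0 + A 2 2) * h
      | linear_combination (A 0 0 + A 1 1) * h
      | linear_combination (-(A 1 1 + A 2 2)) * h
      | linear_combination (-(A 0 0 + A 2 2)) * h
      | linear_combination (-(A 0 0 + A 1 1)) * h

/-- **The columns of `adj(t·1 − M)` are right `t`-eigenvectors of `M`** when `det(t·1 − M) = 0` (`(t·1 − M) · adj(t·1 − M) = det · 1 = 0`; any size, any ring).
[cite: HornJohnson2013, §0.8.2] -/
theorem mulVec_adjugate_col_eq_smul {n : Type*} [Fintype n] [DecidableEq n] (M : Matrix n n R) (t : R)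
    (h : (scalar n t - M).det = 0) (i : n) :
    M *ᵥ (fun k => adjugate (scalar n t - M) k i) = t • (fun k => adjugate (scalar n t - M) k i) := by
  have hmul : (scalar n t - M) * adjugate (scalar n t - M) = 0 := by rw [mul_adjugate, h, zero_smul]
  funext k
  have e := congrFun (congrFun hmul k) i
  simp only [mul_apply, Matrix.sub_apply, scalar_apply, diagonal_apply, sub_mul, Finset.sum_sub_distrib, ite_mul, zero_mul,
    Finset.sum_ite_eq, Finset.mem_univ, if_true, Matrix.zero_apply] at e
  simp only [mulVec, dotProduct, Pi.smul_apply, smul_eq_mul]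
  exact (sub_eq_zero.1 e).symm

/-- **The rows of `adj(t·1 − M)` are left `t`-eigenvectors of `M`** when `det(t·1 − M) = 0` (`adj(t·1 − M) · (t·1 − M) = 0`; any size, any ring).
[cite: HornJohnson2013, §0.8.2] -/
theorem vecMul_adjugate_row_eq_smul {n : Type*} [Fintype n] [DecidableEq n] (M : Matrix n n R) (t : R)
    (h : (scalar n t - M).det = 0) (i : n) :
    (fun k => adjugate (scalar n t - M) i k) ᵥ* M = t • (fun k => adjugate (scalar n t - M) i k) := by
  have hmul : adjugate (scalar n t - M) * (scalar n t - M) = 0 := by rw [adjugate_mul, h, zero_smul]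
  funext k
  have e := congrFun (congrFun hmul i) k
  simp only [mul_apply, Matrix.sub_apply, scalar_apply, diagonal_apply, mul_sub, Finset.sum_sub_distrib, mul_ite, mul_zero,
    Finset.sum_ite_eq', Finset.mem_univ, if_true, Matrix.zero_apply] at e
  simp only [vecMul, dotProduct, Pi.smul_apply, smul_eq_mul]
  rw [mul_comm t]
  exact (sub_eq_zero.1 e).symm

/-- **The pairing at a SIMPLE root.**  If `det(t·1 − M) = 0` and `charpoly′(M)(t) ≠ 0` (e.g. `t` a root of a SEPARABLE characteristic polynomial) then for some `i`
the diagonal adjugate entry `Q i i ≠ 0` (`Q := adj(t·1 − M)`), and the right eigenvector `Q eᵢ` and the left eigenvector `eᵢᵀ Q` pair to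
`Q i i · tr Q ≠ 0` (`R` a domain). [cite: HornJohnson2013, §1.4] -/
theorem exists_adjugate_apply_self_ne_zero [IsDomain R] (M : Matrix (Fin 3) (Fin 3) R) (t : R) (h : (scalar (Fin 3) t - M).det = 0)
    (hd : (derivative M.charpoly).eval t ≠ 0) :
    ∃ i : Fin 3, adjugate (scalar (Fin 3) t - M) i i ≠ 0 ∧
      (fun k => adjugate (scalar (Fin 3) t - M) i k) ⬝ᵥ (fun k => adjugate (scalar (Fin 3) t - M) k i) ≠ 0 := by
  have htr : trace (adjugate (scalar (Fin 3) t - M)) ≠ 0 := by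
    rwa [trace_adjugate_scalar_sub_eq_eval_derivative_charpoly]
  obtain ⟨i, -, hii⟩ : ∃ i ∈ Finset.univ, adjugate (scalar (Fin 3) t - M) i i ≠ 0 := Finset.exists_ne_zero_of_sum_ne_zero htr
  refine ⟨i, hii, ?_⟩
  have e : (fun k => adjugate (scalar (Fin 3) t - M) i k) ⬝ᵥ (fun k => adjugate (scalar (Fin 3) t - M) k i) =
      (adjugate (scalar (Fin 3) t - M) * adjugate (scalar (Fin 3) t - M)) i i := by rw [mul_apply]; rfl
  rw [e, adjugate_mul_adjugate_apply_self_of_det_eq_zero _ h i]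
  exact mul_ne_zero hii htr

end Adjugate

end Summit.HodgeConjecture.HodgeConjecture.Cruxes.H413.F0P3cStCharTSAdjugateEigen
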